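import Literature.Probability.LatticeModels.ScalingLimit
import Literature.Probability.LatticeModels.IsingThermodynamics
import Literature.Probability.LatticeModels.CriticalCorrWellDefined
import HarnessLib

/-!
# Crux `LogPolarProxy.ProxyUniversality` (stmt-CriticalPhenomena-11288), line `birth` — stub S3

`stub_limitLocallyBounded` — **a pointwise scaling limit of the critical `ℤ³` correlators is
locally bounded.** If `(ρ, S)` is a pointwise scaling limit of `criticalCorr 3`
(`HasPointwiseScalingLimit (criticalCorr 3) ρ S`), then for every `n` and every non-coincident
configuration `x ∈ NonCoincident 3 n` there is `C` with `|S n y| ≤ C` for all `y` near `x`.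

Proof (elementary): the critical correlators are box limits of finite-volume expectations of
`±1`-valued spin products, so `|criticalCorr 3 n y| ≤ 1` (`llb_abs_criticalCorr_three_le_one`, a
local copy of `abs_criticalCorr_le_one` of `HighDimPointwiseTriviality.lean`, not imported to keep
the import cone light); hence the rescaled correlator at mesh `δ` is bounded by `|ρ δ| ^ n`
uniformly in the configuration. Locally uniform convergence at `x` with `ε = 1`
(`Metric.tendstoLocallyUniformlyOn_iff`) gives a `𝓝[NonCoincident 3 n] x`-neighbourhood `t` and,
the mesh filter `𝓝[>] 0` being non-trivial, ONE mesh `δ` with `dist (S n y) (F δ y) < 1` on `t`;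
so `|S n y| ≤ |ρ δ| ^ n + 1` on `t`, and `t ∈ 𝓝 x` because `NonCoincident 3 n` is open
(`isOpen_nonCoincident`).

No definitions, no named facts; axioms standard.

References: shape of D. Chelkak, C. Hongler, K. Izyurov, Ann. Math. 181 (2015), Thm 1.1; folklore.
-/

namespace Summit.CriticalPhenomena.Ising3DConformalLimit.Cruxes.ProxyUniversality.Birth

open Filter Set Function Topology
open scoped Topology
open Literature.Probability.LatticeModels

/-- `|⟨∏ᵢ σ_{yᵢ}⟩⁺_{β_c}| ≤ 1` on `ℤ³`: the critical correlator is the box limit of finite-volume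
expectations of a `±1`-valued spin product (`criticalCorr_wellDefined_holds`,
`exists_spinMonomial_eq_spinProduct`, `abs_isingCorr_le_one`). Local copy of
`abs_criticalCorr_le_one` (`HighDimPointwiseTriviality.lean`) at `d = 3`. [folklore] -/
private theorem llb_abs_criticalCorr_three_le_one (n : ℕ) (y : Fin n → Site 3) :
    |criticalCorr 3 n y| ≤ 1 := by
  -- adapted from Literature/Probability/LatticeModels/HighDimPointwiseTriviality.lean
  -- (abs_criticalCorr_le_one), specialised to `d = 3`
  classical
  have h := criticalCorr_wellDefined_holds (d := 3) (by norm_num) n y .plus (by simp)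
  obtain ⟨A, hA⟩ := exists_spinMonomial_eq_spinProduct y
  refine le_of_tendsto' h.abs fun L => ?_
  rw [hA]
  exact abs_isingCorr_le_one (zdGraph 3) (box 3 L) (criticalBeta 3) 0 .plus A

/-- The rescaled critical correlator at mesh `δ` is bounded by `|ρ δ| ^ n`, uniformly in the
configuration: `|ρ(δ)^n ⟨∏ σ_{[yᵢ/δ]}⟩_{β_c}| ≤ |ρ δ| ^ n`. [folklore] -/
private theorem llb_abs_rescaledCorrelator_le (ρ : ℝ → ℝ) (n : ℕ) (δ : ℝ)
    (y : Fin n → EuclideanSpace ℝ (Fin 3)) :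
    |rescaledCorrelator (criticalCorr 3) ρ n δ y| ≤ |ρ δ| ^ n := by
  rw [rescaledCorrelator_apply, abs_mul, abs_pow]
  exact mul_le_of_le_one_right (pow_nonneg (abs_nonneg _) n)
    (llb_abs_criticalCorr_three_le_one n _)

/-- **S3 `stub_limitLocallyBounded` — a pointwise scaling limit of `criticalCorr 3` is locally
bounded on non-coincident configurations.** If `HasPointwiseScalingLimit (criticalCorr 3) ρ S`,
then for every `n` and every `x ∈ NonCoincident 3 n` there is `C : ℝ` with `|S n y| ≤ C` for all
`y` in a neighbourhood of `x` (namely `C = |ρ δ| ^ n + 1` for one mesh `δ` at which the rescaled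
correlator is within `1` of `S n` near `x`). [folklore; shape of ChelkakHonglerIzyurov2015 Thm 1.1] -/
theorem stub_limitLocallyBounded :
    ∀ (ρ : ℝ → ℝ) (S : CorrFamily 3), HasPointwiseScalingLimit (criticalCorr 3) ρ S →
      ∀ (n : ℕ), ∀ x ∈ NonCoincident 3 n, ∃ C : ℝ, ∀ᶠ y in 𝓝 x, |S n y| ≤ C := by
  intro ρ S hlim n x hx
  obtain ⟨t, ht, hev⟩ := Metric.tendstoLocallyUniformlyOn_iff.1 (hlim n) 1 one_pos x hx
  obtain ⟨δ, hδ⟩ := hev.exists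
  refine ⟨|ρ δ| ^ n + 1, ?_⟩
  rw [(isOpen_nonCoincident 3 n).nhdsWithin_eq hx] at ht
  filter_upwards [ht] with y hy
  have h1 : |S n y - rescaledCorrelator (criticalCorr 3) ρ n δ y| < 1 :=
    Real.dist_eq (S n y) _ ▸ hδ y hy
  have h2 := llb_abs_rescaledCorrelator_le ρ n δ y
  have h3 := abs_sub_abs_le_abs_sub (S n y) (rescaledCorrelator (criticalCorr 3) ρ n δ y)
  linarith

end Summit.CriticalPhenomena.Ising3DConformalLimit.Cruxes.ProxyUniversality.Birth
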